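import Summits.AtomisticToContinuum.Crystallization.Theorems.OverbindingBudgetAffineCompressedCutSharpA
import Summits.AtomisticToContinuum.Crystallization.Theorems.OverbindingBudgetAffineCompressedCutReading

/-!
# NODE g82 «SharpB», toward the open leaf NS♭₂ — part (iii), SHARP COLUMN: the record's column charts re-measured from the seed
# (rider S3 of the «Sharp(β)» plan, POINTERS-g83 §4d; potential-free)

Route `OverbindingBudget` (Crystallization), crux `RobustDefectLimitWindows` (stmt-AtomisticToContinuum-31280), decomp-a2c lens 4, generation 82.
Open leaf of record: `…OverbindingBudgetAffineCompressedCutFirst….NearFieldSlackMinSecond 12 (1/25)` («NS♭₂»).  The inner label sum of part (iii)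
(`…CompressedCutOuter.inner_sub_tail_le_nearLoad`) needs the positions of the inner sites to accuracy `dR ν p` along label paths of length
`p = |ℓ| + hexdist ≤ 10`; the layer-rigidity record (`…CompressedCutFrame.layer_rigidity_of_affDeepReg`, clauses 1–3) exports the uniform
`(tauR ν 31, dR ν 31)`.  «SharpA» supplied the one-step engine `sharp_step`; THIS FILE runs it up and down the COLUMN of the record:

* §1 `chart_eq_of_linked` — same-site chart identification across copies (two charts of one site, both carrying its pattern, both linked to the base
  frame with `6(τ + τ′) < β`, are equal); used to give the record's chart of the base site the seed's link `0`.
* §2 numbers: `step_amounts_window` (the per-step increments under the record windows `nn ≤ 1.0347ν` are covered by the `(tauR, dR)` recursion of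
  `…Budget`), `twelve_tauR_lt` (`12·tauR ν 31 < (399/400)ν`), `room` (`tsq λ ≤ 948 ⇒ ‖B(mv λ)‖ ≤ (15/2)ν`), `tsq_col_le`; §3 label algebra.
* §4 `record_at` — fetching the record's establishment of a label of layer `ℓ` (clause 1) from `InLayer (λ − ref ℓ)` and the coordinate box.
* §5 ★ `advance` — `sharp_step` dressed with the record numbers: a parent established SHARP at depth `p` (`(tauR ν p, dR ν p)`, `p + 1 ≤ 31`), a first-shell
  vector of its copy, the record's establishment of the child label ⟹ the child's record site / chart / copy carry `(tauR ν (p+1), dR ν (p+1))`.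
* §6 `ref_form` — from clause 2 (`ref (ℓ+1) = ref ℓ + capv 1 (e ℓ) (1,1,−2)`, `e = ±1`) and clause 3 (`ref 0 + x₀ = 0`): the column label of layer `±n` is
  `ref (±n) + x₀ = (±2n + σ, ±2n + σ, ±2n − 2σ)` with `|σ| ≤ n`, `σ ≡ n (mod 2)`.
* §7 ★★ `sharp_column` — by induction on `n ≤ 5`: the record's site of the column label of layer `±n` is established with the record's chart and copy
  `Cz (±n)` and the SHARP constants `(tauR ν n, dR ν n)`; base: the record's chart at `i` coincides with the seed chart (§1), so its link is `0`.
The hypotheses are the record's clauses 1–3 VERBATIM (base frame `B` generic with `(399/400)ν‖z‖ ≤ ‖Bz‖ ≤ (401/400)ν‖z‖` and a seed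
`Estab y A P B i i M₀ C₀ 0 0 0`; for the record's frame `(ν A_i) ∘ Φ_s` these are `…Establish.base_lower/upper` with `lower_flip/upper_flip` and
`estab_flip (seed_fcc|seed_hcp)`).  Next («SharpC»): the ring induction over the hex distance (`…Seed.hex_descent`) at each layer, and the packaging
`‖y k − y i − B(mv(ref ℓ + x))‖ ≤ dR ν (|ℓ| + lnorm (x − x₀)/6)` consumed by «Inner».

Deps: `…CompressedCutSharpA`, `…CompressedCutReading`.  No `instance`, no `notation`, no `set_option`, no new definitions, no axioms, 0 sorry.
-/

namespace Summit.AtomisticToContinuum.Crystallization.Theorems.OverbindingBudgetAffineCompressedCutSharpB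

open Literature.Geometry.DiscreteGeometry (nearestDist nearestDist_nonneg fccTwoShellPattern hcpTwoShellPattern norm_le_sqrt_two_of_mem_twoShellPattern)
open Summit.AtomisticToContinuum.Crystallization.Theorems.OverbindingBudgetAffineCompressedCutKernel (T3 tsub tadd tneg tsq thsum fccL fccNegL hcpL hcpAltL)
open Summit.AtomisticToContinuum.Crystallization.Theorems.OverbindingBudgetAffineCompressedCutExact (linearMap_eq_of_eq_on_triple)
open Summit.AtomisticToContinuum.Crystallization.Theorems.OverbindingBudgetAffineCompressedCutCharts (mv mv_zero norm_mv_sq linearIndependent_mv ListedBy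
  listedBy_fcc listedBy_hcp Carries)
open Summit.AtomisticToContinuum.Crystallization.Theorems.OverbindingBudgetAffineCompressedCutEstablish (Estab charts_close link_nonneg site_eq_of_close)
open Summit.AtomisticToContinuum.Crystallization.Theorems.OverbindingBudgetAffineCompressedCutSeed (InLayer estab_mono)
open Summit.AtomisticToContinuum.Crystallization.Theorems.OverbindingBudgetAffineCompressedCutPatch (capv dL)
open Summit.AtomisticToContinuum.Crystallization.Theorems.OverbindingBudgetAffineCompressedCutLevels (tsq_capv tneg_capv)
open Summit.AtomisticToContinuum.Crystallization.Theorems.OverbindingBudgetAffineCompressedCutBudget (tauR dR tauR_succ dR_succ tauR_dR_mono record_numbers)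
open Summit.AtomisticToContinuum.Crystallization.Theorems.OverbindingBudgetAffineCompressedCutSharpA (eq_of_mv_close sharp_step)

variable {N : ℕ}

/-! ## §1  Same-site chart identification across copies -/

/-- ★ **TWO LINKED CHARTS OF ONE SITE ARE EQUAL.**  `Pj ∈ {fcc, hcp}`; `M`, `M′` carry `Pj` onto copies `C`, `C′` (arbitrary); both are linked to the base
frame `B` (lower bound `β`) through the same frame map `T` with `6(τ + τ′) < β`.  Then `M = M′`: on pattern points both are lattice-valued and
`(τ+τ′)√2/β < 1/√18`-close (`…Establish.charts_close`, «SharpA».`eq_of_mv_close`), and the pattern spans. [this file] -/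
theorem chart_eq_of_linked {Pj : Finset (EuclideanSpace ℝ (Fin 3))} (hPj : Pj = fccTwoShellPattern ∨ Pj = hcpTwoShellPattern)
    {M M' : EuclideanSpace ℝ (Fin 3) →ₗᵢ[ℝ] EuclideanSpace ℝ (Fin 3)} {C C' : List T3} (hC : Carries M Pj C) (hC' : Carries M' Pj C')
    {B : EuclideanSpace ℝ (Fin 3) →ₗ[ℝ] EuclideanSpace ℝ (Fin 3)} {β τ τ' : ℝ} (hB : ∀ z, β * ‖z‖ ≤ ‖B z‖)
    {T : EuclideanSpace ℝ (Fin 3) → EuclideanSpace ℝ (Fin 3)} (hl : ∀ x, ‖T x - B (M x)‖ ≤ τ * ‖x‖) (hl' : ∀ x, ‖T x - B (M' x)‖ ≤ τ' * ‖x‖)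
    (hsmall : 6 * (τ + τ') < β) : ∀ x, M x = M' x := by
  have hcl := charts_close hB hl hl'
  obtain ⟨hτ, hτ'⟩ := And.intro (link_nonneg hl) (link_nonneg hl')
  have hβ : 0 < β := by linarith
  have hPt : ∀ w ∈ Pj, M w = M' w := by
    intro w hw
    obtain ⟨X, -, hX⟩ := hC.1 w hw
    obtain ⟨X', -, hX'⟩ := hC'.1 w hw
    have h1 := hcl w
    have h2 : ‖w‖ ≤ Real.sqrt 2 := norm_le_sqrt_two_of_mem_twoShellPattern hPj hw
    have h3 : β * ‖M w - M' w‖ ≤ (τ + τ') * Real.sqrt 2 := h1.trans (mul_le_mul_of_nonneg_left h2 (by linarith))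
    have hs : Real.sqrt 2 ^ 2 = 2 := Real.sq_sqrt (by norm_num)
    have h4 : (β * ‖M w - M' w‖) ^ 2 ≤ ((τ + τ') * Real.sqrt 2) ^ 2 := pow_le_pow_left₀ (mul_nonneg hβ.le (norm_nonneg _)) h3 2
    have h5 : ((τ + τ') * Real.sqrt 2) ^ 2 = 2 * (τ + τ') ^ 2 := by rw [mul_pow, hs]; ring
    have h6 : (6 * (τ + τ')) ^ 2 < β ^ 2 := pow_lt_pow_left₀ hsmall (by linarith) two_ne_zero
    have h7 : 18 * ‖M w - M' w‖ ^ 2 < 1 := by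
      by_contra h8
      push Not at h8
      have h9 : β ^ 2 * 1 ≤ β ^ 2 * (18 * ‖M w - M' w‖ ^ 2) := mul_le_mul_of_nonneg_left h8 (sq_nonneg β)
      have h10 : β ^ 2 * (18 * ‖M w - M' w‖ ^ 2) = 18 * (β * ‖M w - M' w‖) ^ 2 := by ring
      rw [h10] at h9
      rw [h5] at h4
      linarith
    rw [hX, hX'] at h7 ⊢
    rw [eq_of_mv_close h7]
  obtain ⟨S, hS, hL⟩ : ∃ S : List T3, (S = fccL ∨ S = hcpL) ∧ ListedBy Pj S := by
    rcases hPj with rfl | rfl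
    · exact ⟨fccL, Or.inl rfl, listedBy_fcc⟩
    · exact ⟨hcpL, Or.inr rfl, listedBy_hcp⟩
  have m6 : ((6 : ℤ), (0 : ℤ), (0 : ℤ)) ∈ S ∧ ((0 : ℤ), (6 : ℤ), (0 : ℤ)) ∈ S ∧ ((0 : ℤ), (0 : ℤ), (6 : ℤ)) ∈ S := by
    rcases hS with rfl | rfl <;> decide
  have hli : LinearIndependent ℝ ![mv (6, 0, 0), mv (0, 6, 0), mv (0, 0, 6)] := linearIndependent_mv (by decide)
  have key := linearMap_eq_of_eq_on_triple (T := M.toLinearMap) (T' := M'.toLinearMap) hli (fun t => by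
    fin_cases t
    · simpa using hPt _ (hL.2 _ m6.1)
    · simpa using hPt _ (hL.2 _ m6.2.1)
    · simpa using hPt _ (hL.2 _ m6.2.2))
  intro x
  simpa using LinearMap.congr_fun key x

/-! ## §2  Numbers -/

/-- The per-step increments under the record windows: `(5/2)(2·10⁻⁴X + 10⁻⁴Y) ≤ (39/50000)ν` and `10⁻⁴X ≤ (13/125000)ν` for `X, Y ≤ 1.0347ν`. [this file] -/
theorem step_amounts_window {ν X Y : ℝ} (hν : 0 ≤ ν) (hX : X ≤ 10347 / 10000 * ν) (hY : Y ≤ 10347 / 10000 * ν) :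
    5 / 2 * (2 * (1 / 10 ^ 4) * X + 1 / 10 ^ 4 * Y) ≤ 39 / 50000 * ν ∧ 1 / 10 ^ 4 * X ≤ 13 / 125000 * ν := by
  constructor <;> nlinarith

/-- `12·tauR ν 31 = 0.29016ν < (399/400)ν`. [this file] -/
theorem twelve_tauR_lt {ν : ℝ} (hν : 0 < ν) : 12 * tauR ν 31 < 399 / 400 * ν := by
  simp only [tauR]
  push_cast
  nlinarith

/-- **Room.**  A label of `tsq ≤ 948` (model length `≤ 7.26`) is charted by a base frame of operator norm `≤ (401/400)ν` within `(15/2)ν`. [this file] -/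
theorem room {ν : ℝ} (hν : 0 ≤ ν) {B : EuclideanSpace ℝ (Fin 3) →ₗ[ℝ] EuclideanSpace ℝ (Fin 3)} (hBup : ∀ z, ‖B z‖ ≤ 401 / 400 * ν * ‖z‖)
    {r : T3} (hr : tsq r ≤ 948) : ‖B (mv r)‖ ≤ 15 / 2 * ν := by
  have h1 : ‖mv r‖ ^ 2 ≤ 948 / 18 := by
    rw [norm_mv_sq]
    have h : (tsq r : ℝ) ≤ 948 := by exact_mod_cast hr
    linarith
  have h2 : ‖mv r‖ ≤ 73 / 10 := by nlinarith [norm_nonneg (mv r)]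
  calc ‖B (mv r)‖ ≤ 401 / 400 * ν * ‖mv r‖ := hBup _
    _ ≤ 401 / 400 * ν * (73 / 10) := mul_le_mul_of_nonneg_left h2 (by positivity)
    _ ≤ 15 / 2 * ν := by linarith

/-- Column labels are short: `tsq (2k + σ, 2k + σ, 2k − 2σ) = 12k² + 6σ² ≤ 450 ≤ 948` for `|k|, |σ| ≤ 5`. [this file] -/
theorem tsq_col_le {a b c k σ : ℤ} (ha : a = 2 * k + σ) (hb : b = 2 * k + σ) (hc : c = 2 * k - 2 * σ) (hk : |k| ≤ 5) (hσ : |σ| ≤ 5) :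
    tsq (a, b, c) ≤ 948 := by
  obtain ⟨hk1, hk2⟩ := abs_le.mp hk
  obtain ⟨hs1, hs2⟩ := abs_le.mp hσ
  have e : tsq (a, b, c) = 12 * k ^ 2 + 6 * σ ^ 2 := by
    subst ha hb hc
    simp only [tsq]
    ring
  rw [e]
  nlinarith

/-! ## §3  Label algebra -/

/-- `(a + b) − a = b`. [this file] -/
private theorem tsub_tadd_left (a b : T3) : tsub (tadd a b) a = b := by
  obtain ⟨a₁, a₂, a₃⟩ := a
  obtain ⟨b₁, b₂, b₃⟩ := b
  simp only [tadd, tsub]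
  refine Prod.ext ?_ (Prod.ext ?_ ?_) <;> dsimp only <;> ring

/-- `(a + b) + c = (a + c) + b`. [this file] -/
theorem tadd_right_comm (a b c : T3) : tadd (tadd a b) c = tadd (tadd a c) b := by
  obtain ⟨a₁, a₂, a₃⟩ := a
  obtain ⟨b₁, b₂, b₃⟩ := b
  obtain ⟨c₁, c₂, c₃⟩ := c
  simp only [tadd]
  refine Prod.ext ?_ (Prod.ext ?_ ?_) <;> dsimp only <;> ring

/-- `((R + c) + x) + (−c) = R + x`. [this file] -/
theorem tadd_tadd_tneg_cancel (R c x : T3) : tadd (tadd (tadd R c) x) (tneg c) = tadd R x := by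
  obtain ⟨R₁, R₂, R₃⟩ := R
  obtain ⟨c₁, c₂, c₃⟩ := c
  obtain ⟨x₁, x₂, x₃⟩ := x
  simp only [tadd, tneg]
  refine Prod.ext ?_ (Prod.ext ?_ ?_) <;> dsimp only <;> ring

/-! ## §4  Fetching the record's establishment of a label -/

/-- **RECORD FETCH** (clause 1 of the layer-rigidity record, base frame `B`): a label `λ` of layer `ℓ` (`InLayer (λ − ref ℓ)`) whose offset from the
column `u = λ − 2ℓ(1,1,1)` is in the box `18 − |ℓ|` has a record site `k` (distance `≤ 12ν`, window `[0.9026ν, 1.0347ν]`) established with a chart onto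
`Cz ℓ`, label `λ`, constants `(tauR ν 31, dR ν 31)`. [this file] -/
theorem record_at {y : Fin N → EuclideanSpace ℝ (Fin 3)} {i : Fin N} {A : Fin N → (EuclideanSpace ℝ (Fin 3) →ₗ[ℝ] EuclideanSpace ℝ (Fin 3))}
    {P : Fin N → Finset (EuclideanSpace ℝ (Fin 3))} {B : EuclideanSpace ℝ (Fin 3) →ₗ[ℝ] EuclideanSpace ℝ (Fin 3)} {ref : ℤ → T3} {Cz : ℤ → List T3}
    (hRec1 : ∀ ℓ : ℤ, -5 ≤ ℓ → ℓ ≤ 5 → Cz ℓ ∈ [fccL, fccNegL, hcpL, hcpAltL] ∧ thsum (ref ℓ) = 6 * ℓ ∧ (ref ℓ).2.1 = (ref ℓ).1 ∧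
      (3 : ℤ) ∣ ((ref ℓ).2.1 - (ref ℓ).2.2) ∧
      ∀ u : T3, InLayer (tsub (tadd (2 * ℓ, 2 * ℓ, 2 * ℓ) u) (ref ℓ)) → |u.1| ≤ 18 - |ℓ| → |u.2.1| ≤ 18 - |ℓ| → |u.2.2| ≤ 18 - |ℓ| →
        ∃ k : Fin N, ∃ M : EuclideanSpace ℝ (Fin 3) →ₗᵢ[ℝ] EuclideanSpace ℝ (Fin 3),
          dist (y k) (y i) ≤ 12 * nearestDist y i ∧ 9026 / 10000 * nearestDist y i ≤ nearestDist y k ∧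
          nearestDist y k ≤ 10347 / 10000 * nearestDist y i ∧
          Estab y A P B i k M (Cz ℓ) (tadd (2 * ℓ, 2 * ℓ, 2 * ℓ) u) (tauR (nearestDist y i) 31) (dR (nearestDist y i) 31))
    {ℓ : ℤ} (hℓ1 : -5 ≤ ℓ) (hℓ2 : ℓ ≤ 5) {L : T3} (hL : InLayer (tsub L (ref ℓ)))
    (hbox : |(tsub L (2 * ℓ, 2 * ℓ, 2 * ℓ)).1| ≤ 18 - |ℓ| ∧ |(tsub L (2 * ℓ, 2 * ℓ, 2 * ℓ)).2.1| ≤ 18 - |ℓ| ∧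
      |(tsub L (2 * ℓ, 2 * ℓ, 2 * ℓ)).2.2| ≤ 18 - |ℓ|) :
    ∃ k : Fin N, ∃ M : EuclideanSpace ℝ (Fin 3) →ₗᵢ[ℝ] EuclideanSpace ℝ (Fin 3),
      dist (y k) (y i) ≤ 12 * nearestDist y i ∧ 9026 / 10000 * nearestDist y i ≤ nearestDist y k ∧
      nearestDist y k ≤ 10347 / 10000 * nearestDist y i ∧ Estab y A P B i k M (Cz ℓ) L (tauR (nearestDist y i) 31) (dR (nearestDist y i) 31) := by
  have e : tadd (2 * ℓ, 2 * ℓ, 2 * ℓ) (tsub L (2 * ℓ, 2 * ℓ, 2 * ℓ)) = L :=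
    Summit.AtomisticToContinuum.Crystallization.Theorems.OverbindingBudgetAffineCompressedCutEstablish.tadd_tsub_cancel _ _
  obtain ⟨k, M, h1, h2, h3, hE⟩ := (hRec1 ℓ hℓ1 hℓ2).2.2.2.2 (tsub L (2 * ℓ, 2 * ℓ, 2 * ℓ)) (by rw [e]; exact hL) hbox.1 hbox.2.1 hbox.2.2
  rw [e] at hE
  exact ⟨k, M, h1, h2, h3, hE⟩

/-! ## §5  The dressed sharp step -/

/-- ★ **ADVANCE.**  Ball data at `i` (radius `12·nn_i`), base frame bounded below by `(399/400)ν`; a parent `k` (distance `≤ 12ν`, `nn_k ≤ 1.0347ν`)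
established with `(tauR ν p, dR ν p)`, `p + 1 ≤ 31`; a first-shell vector `x` of its copy with the child label of `tsq`-room `≤ 948`·(…) — given as
`‖B(mv(λ + x))‖ ≤ (15/2)ν`; the record's establishment of the child label at `k′` (window `[0.9026ν, 1.0347ν]`, `(tauR ν 31, dR ν 31)`).  Then the record's
site, chart and copy of the child carry `(tauR ν (p+1), dR ν (p+1))`. [this file] -/
theorem advance {y : Fin N → EuclideanSpace ℝ (Fin 3)} (hy : Function.Injective y) {i : Fin N} (hν : 0 < nearestDist y i)
    {A : Fin N → (EuclideanSpace ℝ (Fin 3) →ₗ[ℝ] EuclideanSpace ℝ (Fin 3))} {Qf : Fin N → (EuclideanSpace ℝ (Fin 3) →ₗᵢ[ℝ] EuclideanSpace ℝ (Fin 3))}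
    {P : Fin N → Finset (EuclideanSpace ℝ (Fin 3))} {f : Fin N → EuclideanSpace ℝ (Fin 3) → EuclideanSpace ℝ (Fin 3)}
    {B : EuclideanSpace ℝ (Fin 3) →ₗ[ℝ] EuclideanSpace ℝ (Fin 3)}
    (hP : ∀ j, dist (y j) (y i) ≤ 12 * nearestDist y i → (P j = fccTwoShellPattern ∨ P j = hcpTwoShellPattern))
    (hA : ∀ j, dist (y j) (y i) ≤ 12 * nearestDist y i → ∀ v ∈ P j, ‖A j v - Qf j v‖ ≤ 1 / 1000)
    (hf : ∀ j, dist (y j) (y i) ≤ 12 * nearestDist y i → ∀ v ∈ P j,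
      f j v ∈ Set.range y ∧ dist (f j v) (y j + nearestDist y j • A j v) ≤ 1 / 10 ^ 4 * nearestDist y j)
    (hinj : ∀ j, dist (y j) (y i) ≤ 12 * nearestDist y i → Set.InjOn (f j) ↑(P j))
    (hex : ∀ j, dist (y j) (y i) ≤ 12 * nearestDist y i → ∀ m, m ≠ j → dist (y m) (y j) ≤ (3 / 2 + 1 / 450) * nearestDist y j →
      ∃ v ∈ P j, f j v = y m)
    (hBlo : ∀ z, 399 / 400 * nearestDist y i * ‖z‖ ≤ ‖B z‖)
    {k : Fin N} {M : EuclideanSpace ℝ (Fin 3) →ₗᵢ[ℝ] EuclideanSpace ℝ (Fin 3)} {C : List T3} {L₀ : T3} {p : ℕ} (hp : p + 1 ≤ 31)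
    (hk12 : dist (y k) (y i) ≤ 12 * nearestDist y i) (hkhi : nearestDist y k ≤ 10347 / 10000 * nearestDist y i)
    (hE : Estab y A P B i k M C L₀ (tauR (nearestDist y i) p) (dR (nearestDist y i) p)) {x : T3} (hxC : x ∈ C) (hx18 : tsq x = 18)
    (hroom : ‖B (mv (tadd L₀ x))‖ ≤ 15 / 2 * nearestDist y i)
    {k' : Fin N} {M' : EuclideanSpace ℝ (Fin 3) →ₗᵢ[ℝ] EuclideanSpace ℝ (Fin 3)} {C' : List T3}
    (hk'lo : 9026 / 10000 * nearestDist y i ≤ nearestDist y k') (hk'hi : nearestDist y k' ≤ 10347 / 10000 * nearestDist y i)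
    (hE' : Estab y A P B i k' M' C' (tadd L₀ x) (tauR (nearestDist y i) 31) (dR (nearestDist y i) 31)) :
    Estab y A P B i k' M' C' (tadd L₀ x) (tauR (nearestDist y i) (p + 1)) (dR (nearestDist y i) (p + 1)) := by
  obtain ⟨-, hτ31, -, hD31⟩ := tauR_dR_mono hν.le hp
  obtain ⟨hτ0, -, -, -⟩ := tauR_dR_mono hν.le (le_refl 31)
  obtain ⟨ha1, ha2⟩ := step_amounts_window hν.le hkhi hk'hi
  have hrn := record_numbers hν
  have h12 := twelve_tauR_lt hν
  have hτle : tauR (nearestDist y i) p + 5 / 2 * (2 * (1 / 10 ^ 4) * nearestDist y k + 1 / 10 ^ 4 * nearestDist y k') ≤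
      tauR (nearestDist y i) (p + 1) := by
    rw [tauR_succ]; linarith
  have hDle : dR (nearestDist y i) p + 1 / 10 ^ 4 * nearestDist y k + tauR (nearestDist y i) p ≤ dR (nearestDist y i) (p + 1) := by
    rw [dR_succ]; linarith
  have hX0 : 0 ≤ 1 / 10 ^ 4 * (10347 / 10000 * nearestDist y i) := by positivity
  have hball : ‖B (mv (tadd L₀ x))‖ + (dR (nearestDist y i) p + 1 / 10 ^ 4 * nearestDist y k + tauR (nearestDist y i) p) ≤
      12 * nearestDist y i := by linarith [hrn.2.2.2.1]
  have hclose : (dR (nearestDist y i) p + 1 / 10 ^ 4 * nearestDist y k + tauR (nearestDist y i) p) + dR (nearestDist y i) 31 <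
      nearestDist y k' := by linarith [hrn.2.1]
  have hsmall : 6 * ((tauR (nearestDist y i) p + 5 / 2 * (2 * (1 / 10 ^ 4) * nearestDist y k + 1 / 10 ^ 4 * nearestDist y k')) +
      tauR (nearestDist y i) 31) < 399 / 400 * nearestDist y i := by linarith
  exact estab_mono (sharp_step hy hP hA hf hinj hex hBlo hk12 hE hxC hx18 hball hE' hclose hsmall) hτle hDle

/-! ## §6  The shape of the column labels -/

/-- **COLUMN LABELS.**  From clause 2 (`e ℓ = ±1`, `ref (ℓ+1) = ref ℓ + capv 1 (e ℓ) (1,1,−2)`) and clause 3 (`ref 0 + x₀ = 0`): for `n ≤ 5`,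
`ref (±n) + x₀ = (±2n + σ, ±2n + σ, ±2n − 2σ)` with `|σ| ≤ n` and `σ + n` even. [this file] -/
theorem ref_form {ref : ℤ → T3} {Cz : ℤ → List T3} {e : ℤ → ℤ} {x₀ : T3}
    (hRec2 : ∀ ℓ : ℤ, -5 ≤ ℓ → ℓ ≤ 4 → (e ℓ = 1 ∨ e ℓ = -1) ∧ ref (ℓ + 1) = tadd (ref ℓ) (capv 1 (e ℓ) (1, 1, -2)) ∧
      (∀ δ ∈ dL, capv 1 (e ℓ) δ ∈ Cz ℓ) ∧ (∀ δ ∈ dL, capv (-1) (-(e ℓ)) δ ∈ Cz (ℓ + 1)))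
    (hx₀ : tadd (ref 0) x₀ = (0, 0, 0)) (n : ℕ) (hn : n ≤ 5) :
    (∃ σ : ℤ, |σ| ≤ n ∧ (2 : ℤ) ∣ (σ + n) ∧ tadd (ref (n : ℤ)) x₀ = (2 * (n : ℤ) + σ, 2 * (n : ℤ) + σ, 2 * (n : ℤ) - 2 * σ)) ∧
    (∃ σ : ℤ, |σ| ≤ n ∧ (2 : ℤ) ∣ (σ + n) ∧
      tadd (ref (-(n : ℤ))) x₀ = (-2 * (n : ℤ) + σ, -2 * (n : ℤ) + σ, -2 * (n : ℤ) - 2 * σ)) := by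
  induction n with
  | zero =>
    refine ⟨⟨0, by simp, by simp, ?_⟩, ⟨0, by simp, by simp, ?_⟩⟩
    · simpa using hx₀
    · simpa using hx₀
  | succ m ih =>
    obtain ⟨⟨σ, hσ, hpar, hm⟩, ⟨σ', hσ', hpar', hm'⟩⟩ := ih (by omega)
    obtain ⟨hs1, hs2⟩ := abs_le.mp hσ
    obtain ⟨hs1', hs2'⟩ := abs_le.mp hσ'
    constructor
    · obtain ⟨he, hr, -, -⟩ := hRec2 (m : ℤ) (by omega) (by omega)
      refine ⟨σ + e m, abs_le.mpr ⟨?_, ?_⟩, ?_, ?_⟩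
      · rcases he with h | h <;> rw [h] <;> push_cast <;> omega
      · rcases he with h | h <;> rw [h] <;> push_cast <;> omega
      · rcases he with h | h <;> rw [h] <;> push_cast <;> omega
      · push_cast
        rw [hr, tadd_right_comm, hm]
        simp only [tadd, capv, Prod.mk.injEq]
        refine ⟨by ring, by ring, by ring⟩
    · obtain ⟨he, hr, -, -⟩ := hRec2 (-((m : ℤ) + 1)) (by omega) (by omega)
      have e1 : -((m : ℤ) + 1) + 1 = -(m : ℤ) := by ring
      rw [e1] at hr
      refine ⟨σ' - e (-((m : ℤ) + 1)), abs_le.mpr ⟨?_, ?_⟩, ?_, ?_⟩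
      · rcases he with h | h <;> rw [h] <;> push_cast <;> omega
      · rcases he with h | h <;> rw [h] <;> push_cast <;> omega
      · rcases he with h | h <;> rw [h] <;> push_cast <;> omega
      · push_cast
        rw [hr, tadd_right_comm] at hm'
        simp only [tadd, capv, Prod.mk.injEq] at hm' ⊢
        obtain ⟨h1, h2, h3⟩ := hm'
        refine ⟨by linarith, by linarith, by linarith⟩

/-! ## §7  THE SHARP COLUMN -/

/-- ★★ **SHARP COLUMN.**  Under the ball data, the base-frame bounds, a seed `Estab y A P B i i M₀ C₀ 0 0 0`, and the record's clauses 1–3: for `n ≤ 5` the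
record's sites of the column labels `ref (±n) + x₀` are established with the record's charts onto `Cz (±n)` and the SHARP constants `(tauR ν n, dR ν n)`,
at distance `≤ 12ν` from `i` and in the window `[0.9026ν, 1.0347ν]`. [this file] -/
theorem sharp_column {y : Fin N → EuclideanSpace ℝ (Fin 3)} (hy : Function.Injective y) {i : Fin N} (hν : 0 < nearestDist y i)
    {A : Fin N → (EuclideanSpace ℝ (Fin 3) →ₗ[ℝ] EuclideanSpace ℝ (Fin 3))} {Qf : Fin N → (EuclideanSpace ℝ (Fin 3) →ₗᵢ[ℝ] EuclideanSpace ℝ (Fin 3))}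
    {P : Fin N → Finset (EuclideanSpace ℝ (Fin 3))} {f : Fin N → EuclideanSpace ℝ (Fin 3) → EuclideanSpace ℝ (Fin 3)}
    {B : EuclideanSpace ℝ (Fin 3) →ₗ[ℝ] EuclideanSpace ℝ (Fin 3)}
    (hP : ∀ j, dist (y j) (y i) ≤ 12 * nearestDist y i → (P j = fccTwoShellPattern ∨ P j = hcpTwoShellPattern))
    (hA : ∀ j, dist (y j) (y i) ≤ 12 * nearestDist y i → ∀ v ∈ P j, ‖A j v - Qf j v‖ ≤ 1 / 1000)
    (hf : ∀ j, dist (y j) (y i) ≤ 12 * nearestDist y i → ∀ v ∈ P j,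
      f j v ∈ Set.range y ∧ dist (f j v) (y j + nearestDist y j • A j v) ≤ 1 / 10 ^ 4 * nearestDist y j)
    (hinj : ∀ j, dist (y j) (y i) ≤ 12 * nearestDist y i → Set.InjOn (f j) ↑(P j))
    (hex : ∀ j, dist (y j) (y i) ≤ 12 * nearestDist y i → ∀ m, m ≠ j → dist (y m) (y j) ≤ (3 / 2 + 1 / 450) * nearestDist y j →
      ∃ v ∈ P j, f j v = y m)
    (hBlo : ∀ z, 399 / 400 * nearestDist y i * ‖z‖ ≤ ‖B z‖) (hBup : ∀ z, ‖B z‖ ≤ 401 / 400 * nearestDist y i * ‖z‖)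
    (hseed : ∃ (M₀ : EuclideanSpace ℝ (Fin 3) →ₗᵢ[ℝ] EuclideanSpace ℝ (Fin 3)) (C₀ : List T3), Estab y A P B i i M₀ C₀ (0, 0, 0) 0 0)
    {ref : ℤ → T3} {Cz : ℤ → List T3} {e : ℤ → ℤ} {x₀ : T3}
    (hRec1 : ∀ ℓ : ℤ, -5 ≤ ℓ → ℓ ≤ 5 → Cz ℓ ∈ [fccL, fccNegL, hcpL, hcpAltL] ∧ thsum (ref ℓ) = 6 * ℓ ∧ (ref ℓ).2.1 = (ref ℓ).1 ∧
      (3 : ℤ) ∣ ((ref ℓ).2.1 - (ref ℓ).2.2) ∧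
      ∀ u : T3, InLayer (tsub (tadd (2 * ℓ, 2 * ℓ, 2 * ℓ) u) (ref ℓ)) → |u.1| ≤ 18 - |ℓ| → |u.2.1| ≤ 18 - |ℓ| → |u.2.2| ≤ 18 - |ℓ| →
        ∃ k : Fin N, ∃ M : EuclideanSpace ℝ (Fin 3) →ₗᵢ[ℝ] EuclideanSpace ℝ (Fin 3),
          dist (y k) (y i) ≤ 12 * nearestDist y i ∧ 9026 / 10000 * nearestDist y i ≤ nearestDist y k ∧
          nearestDist y k ≤ 10347 / 10000 * nearestDist y i ∧
          Estab y A P B i k M (Cz ℓ) (tadd (2 * ℓ, 2 * ℓ, 2 * ℓ) u) (tauR (nearestDist y i) 31) (dR (nearestDist y i) 31))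
    (hRec2 : ∀ ℓ : ℤ, -5 ≤ ℓ → ℓ ≤ 4 → (e ℓ = 1 ∨ e ℓ = -1) ∧ ref (ℓ + 1) = tadd (ref ℓ) (capv 1 (e ℓ) (1, 1, -2)) ∧
      (∀ δ ∈ dL, capv 1 (e ℓ) δ ∈ Cz ℓ) ∧ (∀ δ ∈ dL, capv (-1) (-(e ℓ)) δ ∈ Cz (ℓ + 1)))
    (hx₀L : InLayer x₀) (hx₀ : tadd (ref 0) x₀ = (0, 0, 0)) (n : ℕ) (hn : n ≤ 5) :
    (∃ k : Fin N, ∃ M : EuclideanSpace ℝ (Fin 3) →ₗᵢ[ℝ] EuclideanSpace ℝ (Fin 3),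
      dist (y k) (y i) ≤ 12 * nearestDist y i ∧ 9026 / 10000 * nearestDist y i ≤ nearestDist y k ∧
      nearestDist y k ≤ 10347 / 10000 * nearestDist y i ∧
      Estab y A P B i k M (Cz (n : ℤ)) (tadd (ref (n : ℤ)) x₀) (tauR (nearestDist y i) n) (dR (nearestDist y i) n)) ∧
    (∃ k : Fin N, ∃ M : EuclideanSpace ℝ (Fin 3) →ₗᵢ[ℝ] EuclideanSpace ℝ (Fin 3),
      dist (y k) (y i) ≤ 12 * nearestDist y i ∧ 9026 / 10000 * nearestDist y i ≤ nearestDist y k ∧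
      nearestDist y k ≤ 10347 / 10000 * nearestDist y i ∧
      Estab y A P B i k M (Cz (-(n : ℤ))) (tadd (ref (-(n : ℤ))) x₀) (tauR (nearestDist y i) n) (dR (nearestDist y i) n)) := by
  induction n with
  | zero =>
    -- the record's establishment of the label `0` is at `i`; its chart is the seed chart, so its link is `0`
    have hii : dist (y i) (y i) ≤ 12 * nearestDist y i := by
      rw [dist_self]; exact mul_nonneg (by norm_num) (nearestDist_nonneg y i)
    have hL : InLayer (tsub (tadd (ref 0) x₀) (ref 0)) := by rw [tsub_tadd_left]; exact hx₀L
    have hbox : |(tsub (tadd (ref 0) x₀) (2 * 0, 2 * 0, 2 * 0)).1| ≤ 18 - |(0 : ℤ)| ∧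
        |(tsub (tadd (ref 0) x₀) (2 * 0, 2 * 0, 2 * 0)).2.1| ≤ 18 - |(0 : ℤ)| ∧ |(tsub (tadd (ref 0) x₀) (2 * 0, 2 * 0, 2 * 0)).2.2| ≤ 18 - |(0 : ℤ)| := by
      rw [hx₀]; simp [tsub]
    obtain ⟨k₀, M₀, -, hlo, hhi, hE₀⟩ := record_at hRec1 (ℓ := 0) (by norm_num) (by norm_num) hL hbox
    have hrn := record_numbers hν
    have hm : ‖y i - y i - B (mv (tadd (ref 0) x₀))‖ ≤ 0 := by rw [hx₀, mv_zero, map_zero, sub_self, sub_zero, norm_zero]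
    have hik : i = k₀ := site_eq_of_close hm hE₀.2.2 (by linarith [hrn.2.2.2.1])
    subst hik
    obtain ⟨Φ₀, C₀, hS⟩ := hseed
    have heq := chart_eq_of_linked (hP i hii) hE₀.1 hS.1 hBlo hE₀.2.1 hS.2.1 (by linarith [twelve_tauR_lt hν, hrn.2.2.2.1])
    have t0 : tauR (nearestDist y i) 0 = 0 := by simp [tauR]
    have d0 : dR (nearestDist y i) 0 = 0 := by simp [dR]
    have hE : Estab y A P B i i M₀ (Cz 0) (tadd (ref 0) x₀) (tauR (nearestDist y i) 0) (dR (nearestDist y i) 0) := by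
      rw [t0, d0]
      exact ⟨hE₀.1, fun x => by rw [heq x]; exact hS.2.1 x, hm⟩
    refine ⟨⟨i, M₀, hii, hlo, hhi, ?_⟩, ⟨i, M₀, hii, hlo, hhi, ?_⟩⟩
    · simpa using hE
    · simpa using hE
  | succ m ih =>
    obtain ⟨⟨k, M, hk12, -, hkhi, hE⟩, ⟨kd, Md, hkd12, -, hkdhi, hEd⟩⟩ := ih (by omega)
    have hrf := ref_form hRec2 hx₀ (m + 1) hn
    constructor
    · -- UP: layer `m → m + 1`, cap vector `capv 1 (e m) (1,1,−2) ∈ Cz m`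
      obtain ⟨he, hr, hcap, -⟩ := hRec2 (m : ℤ) (by omega) (by omega)
      obtain ⟨⟨σ, hσ, -, hLσ⟩, -⟩ := hrf
      push_cast at hLσ ⊢
      have hxC : capv 1 (e (m : ℤ)) (1, 1, -2) ∈ Cz (m : ℤ) := hcap _ (by decide)
      have hx18 : tsq (capv 1 (e (m : ℤ)) (1, 1, -2)) = 18 := tsq_capv (Or.inl rfl) he _ (by decide)
      have hlab : tadd (tadd (ref (m : ℤ)) x₀) (capv 1 (e (m : ℤ)) (1, 1, -2)) = tadd (ref ((m : ℤ) + 1)) x₀ := by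
        rw [hr]; exact tadd_right_comm _ _ _
      have hm1 : (0 : ℤ) ≤ (m : ℤ) + 1 := by positivity
      obtain ⟨hs1, hs2⟩ := abs_le.mp hσ
      have hL : InLayer (tsub (tadd (ref ((m : ℤ) + 1)) x₀) (ref ((m : ℤ) + 1))) := by rw [tsub_tadd_left]; exact hx₀L
      have hbox : |(tsub (tadd (ref ((m : ℤ) + 1)) x₀) (2 * ((m : ℤ) + 1), 2 * ((m : ℤ) + 1), 2 * ((m : ℤ) + 1))).1| ≤ 18 - |(m : ℤ) + 1| ∧
          |(tsub (tadd (ref ((m : ℤ) + 1)) x₀) (2 * ((m : ℤ) + 1), 2 * ((m : ℤ) + 1), 2 * ((m : ℤ) + 1))).2.1| ≤ 18 - |(m : ℤ) + 1| ∧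
          |(tsub (tadd (ref ((m : ℤ) + 1)) x₀) (2 * ((m : ℤ) + 1), 2 * ((m : ℤ) + 1), 2 * ((m : ℤ) + 1))).2.2| ≤ 18 - |(m : ℤ) + 1| := by
        rw [hLσ, abs_of_nonneg hm1]
        simp only [tsub]
        push_cast at hs1 hs2 ⊢
        exact ⟨abs_le.mpr ⟨by omega, by omega⟩, abs_le.mpr ⟨by omega, by omega⟩, abs_le.mpr ⟨by omega, by omega⟩⟩
      obtain ⟨k', M', hk'12, hk'lo, hk'hi, hE'⟩ := record_at hRec1 (by omega) (by omega) hL hbox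
      rw [← hlab] at hE'
      have hroom : ‖B (mv (tadd (tadd (ref (m : ℤ)) x₀) (capv 1 (e (m : ℤ)) (1, 1, -2))))‖ ≤ 15 / 2 * nearestDist y i := by
        rw [hlab, hLσ]
        push_cast at hσ
        exact room hν.le hBup (tsq_col_le rfl rfl rfl (abs_le.mpr ⟨by omega, by omega⟩) (hσ.trans (by exact_mod_cast hn)))
      have h := advance hy hν hP hA hf hinj hex hBlo (p := m) (by omega) hk12 hkhi hE hxC hx18 hroom hk'lo hk'hi hE'
      rw [hlab] at h
      exact ⟨k', M', hk'12, hk'lo, hk'hi, h⟩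
    · -- DOWN: layer `−m → −(m + 1)`, cap vector `capv (−1) (−e (−(m+1))) (1,1,−2) ∈ Cz (−m)`
      obtain ⟨he, hr, -, hcap'⟩ := hRec2 (-((m : ℤ) + 1)) (by omega) (by omega)
      have e1 : -((m : ℤ) + 1) + 1 = -(m : ℤ) := by ring
      rw [e1] at hr hcap'
      obtain ⟨-, ⟨σ, hσ, -, hLσ⟩⟩ := hrf
      push_cast at hLσ ⊢
      have hxC : capv (-1) (-(e (-((m : ℤ) + 1)))) (1, 1, -2) ∈ Cz (-(m : ℤ)) := hcap' _ (by decide)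
      have he' : -(e (-((m : ℤ) + 1))) = 1 ∨ -(e (-((m : ℤ) + 1))) = -1 := by rcases he with h | h <;> omega
      have hx18 : tsq (capv (-1) (-(e (-((m : ℤ) + 1)))) (1, 1, -2)) = 18 := tsq_capv (Or.inr rfl) he' _ (by decide)
      have hlab : tadd (tadd (ref (-(m : ℤ))) x₀) (capv (-1) (-(e (-((m : ℤ) + 1)))) (1, 1, -2)) = tadd (ref (-((m : ℤ) + 1))) x₀ := by
        rw [hr, ← tneg_capv]; exact tadd_tadd_tneg_cancel _ _ _
      have hm1 : (0 : ℤ) ≤ (m : ℤ) + 1 := by positivity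
      obtain ⟨hs1, hs2⟩ := abs_le.mp hσ
      have hL : InLayer (tsub (tadd (ref (-((m : ℤ) + 1))) x₀) (ref (-((m : ℤ) + 1)))) := by rw [tsub_tadd_left]; exact hx₀L
      have hbox : |(tsub (tadd (ref (-((m : ℤ) + 1))) x₀) (2 * -((m : ℤ) + 1), 2 * -((m : ℤ) + 1), 2 * -((m : ℤ) + 1))).1| ≤
            18 - |-((m : ℤ) + 1)| ∧
          |(tsub (tadd (ref (-((m : ℤ) + 1))) x₀) (2 * -((m : ℤ) + 1), 2 * -((m : ℤ) + 1), 2 * -((m : ℤ) + 1))).2.1| ≤ 18 - |-((m : ℤ) + 1)| ∧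
          |(tsub (tadd (ref (-((m : ℤ) + 1))) x₀) (2 * -((m : ℤ) + 1), 2 * -((m : ℤ) + 1), 2 * -((m : ℤ) + 1))).2.2| ≤ 18 - |-((m : ℤ) + 1)| := by
        rw [hLσ, abs_neg, abs_of_nonneg hm1]
        simp only [tsub]
        push_cast at hs1 hs2 ⊢
        exact ⟨abs_le.mpr ⟨by omega, by omega⟩, abs_le.mpr ⟨by omega, by omega⟩, abs_le.mpr ⟨by omega, by omega⟩⟩
      obtain ⟨k', M', hk'12, hk'lo, hk'hi, hE'⟩ := record_at hRec1 (by omega) (by omega) hL hbox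
      rw [← hlab] at hE'
      have hroom : ‖B (mv (tadd (tadd (ref (-(m : ℤ))) x₀) (capv (-1) (-(e (-((m : ℤ) + 1)))) (1, 1, -2))))‖ ≤ 15 / 2 * nearestDist y i := by
        rw [hlab, hLσ]
        push_cast at hσ
        exact room hν.le hBup (tsq_col_le (k := -((m : ℤ) + 1)) (by ring) (by ring) (by ring)
          (by rw [abs_neg, abs_of_nonneg hm1]; exact_mod_cast hn) (hσ.trans (by exact_mod_cast hn)))
      have h := advance hy hν hP hA hf hinj hex hBlo (p := m) (by omega) hkd12 hkdhi hEd hxC hx18 hroom hk'lo hk'hi hE'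
      rw [hlab] at h
      exact ⟨k', M', hk'12, hk'lo, hk'hi, h⟩

end Summit.AtomisticToContinuum.Crystallization.Theorems.OverbindingBudgetAffineCompressedCutSharpB
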